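import Mathlib

/-!
# Doubly lexical orderings exist (kernel; a tool for orbit-matrix certificates)
Framing: lottery ticket; floor = certified bounds/negative ranges.

Cell pub-namedobj (venture DiscreteObjects), target (M), designs gen 18. Orbit-matrix enumerations outside the kernel (designs g3 `p13om.c` for the
order-13 cell: 836 doubly-lexical matrices → 38 classes; hadamard g5 'block-doubly-lex' normal forms) break the `S_m × S_n` relabelling symmetry by
listing only DOUBLY LEXICAL matrices: rows lexicographically non-increasing from top to bottom AND columns (read top-down) lexicographically
non-increasing from left to right. For a kernel certificate this needs the existence theorem (Lubiw, SIAM J. Comput. 16 (1987) 854–879, "doubly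
lexical orderings of matrices"; here for finite matrices over a linear order, with the descending convention): **every matrix can be brought to doubly
lexical form by a row permutation and a column permutation** (`exists_doublyLex`). Proof (potential argument, not Lubiw's refinement algorithm): take
`(ρ, τ)` maximising the tuple of columns in the lexicographic order of tuples of lexicographic vectors; a column violation `col_j < col_{j'}`, `j < j'`,
is repaired by swapping the two columns, which increases the potential (first change at position `j`); a row violation `row_i < row_{i'}`, `i < i'`,
first differing at column `j₀`, is repaired by swapping the two rows, which leaves the columns before `j₀` unchanged and increases column `j₀` (first
change at position `i`) — again the potential increases; so a maximiser has no violation. Pure order theory (Mathlib `Pi.Lex`); no census content.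
No `sorry`, no new axioms.
-/

namespace Summit.Ventures.DiscreteObjects.PP12

namespace DoublyLex

open Finset

variable {α : Type*} [LinearOrder α] {m n : ℕ}

/-- row `i` of the matrix rearranged by `(ρ, τ)`, as a lexicographic vector -/
def row (M : Fin m → Fin n → α) (ρ : Equiv.Perm (Fin m)) (τ : Equiv.Perm (Fin n)) (i : Fin m) : Lex (Fin n → α) :=
  toLex fun j => M (ρ i) (τ j)

/-- column `j` of the matrix rearranged by `(ρ, τ)`, as a lexicographic vector (read top-down) -/
def col (M : Fin m → Fin n → α) (ρ : Equiv.Perm (Fin m)) (τ : Equiv.Perm (Fin n)) (j : Fin n) : Lex (Fin m → α) :=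
  toLex fun i => M (ρ i) (τ j)

/-- the potential: the tuple of columns, ordered lexicographically -/
def pot (M : Fin m → Fin n → α) (x : Equiv.Perm (Fin m) × Equiv.Perm (Fin n)) : Lex (Fin n → Lex (Fin m → α)) :=
  toLex fun j => col M x.1 x.2 j

/-- the rearrangement `(ρ, τ)` is doubly lexical: rows and columns lexicographically non-increasing -/
structure IsDoublyLex (M : Fin m → Fin n → α) (ρ : Equiv.Perm (Fin m)) (τ : Equiv.Perm (Fin n)) : Prop where
  /-- later rows are lexicographically not larger -/
  rows : ∀ i i' : Fin m, i < i' → row M ρ τ i' ≤ row M ρ τ i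
  /-- later columns are lexicographically not larger -/
  cols : ∀ j j' : Fin n, j < j' → col M ρ τ j' ≤ col M ρ τ j

/-- unfolding the strict lexicographic order on vectors -/
theorem toLex_lt_toLex_iff {k : ℕ} {β : Type*} [LT β] (f g : Fin k → β) :
    toLex f < toLex g ↔ ∃ i, (∀ j, j < i → f j = g j) ∧ f i < g i := Iff.rfl

/-- swapping two violating columns increases the potential -/
theorem pot_lt_swap_cols (M : Fin m → Fin n → α) (ρ : Equiv.Perm (Fin m)) (τ : Equiv.Perm (Fin n)) {j j' : Fin n} (hjj : j < j')
    (hv : col M ρ τ j < col M ρ τ j') : pot M (ρ, τ) < pot M (ρ, (Equiv.swap j j').trans τ) := by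
  rw [pot, pot, toLex_lt_toLex_iff]
  refine ⟨j, fun k hk => ?_, ?_⟩
  · have hk1 : k ≠ j := ne_of_lt hk
    have hk2 : k ≠ j' := ne_of_lt (lt_trans hk hjj)
    simp only [col, Equiv.trans_apply, Equiv.swap_apply_of_ne_of_ne hk1 hk2]
  · simpa only [col, Equiv.trans_apply, Equiv.swap_apply_left] using hv

/-- swapping two violating rows increases the potential -/
theorem pot_lt_swap_rows (M : Fin m → Fin n → α) (ρ : Equiv.Perm (Fin m)) (τ : Equiv.Perm (Fin n)) {i i' : Fin m} (hii : i < i')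
    (hv : row M ρ τ i < row M ρ τ i') : pot M (ρ, τ) < pot M ((Equiv.swap i i').trans ρ, τ) := by
  rw [row, row, toLex_lt_toLex_iff] at hv
  obtain ⟨j₀, hagree, hlt⟩ := hv
  rw [pot, pot, toLex_lt_toLex_iff]
  refine ⟨j₀, fun j hj => ?_, ?_⟩
  · -- columns before `j₀` are unchanged
    simp only [col]
    congr 1
    funext k
    simp only [Equiv.trans_apply]
    by_cases hk1 : k = i
    · subst hk1; rw [Equiv.swap_apply_left]; exact hagree j hj
    · by_cases hk2 : k = i'
      · subst hk2; rw [Equiv.swap_apply_right]; exact (hagree j hj).symm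
      · rw [Equiv.swap_apply_of_ne_of_ne hk1 hk2]
  · -- column `j₀` increases, first change in row `i`
    rw [col, col, toLex_lt_toLex_iff]
    refine ⟨i, fun k hk => ?_, ?_⟩
    · have hk1 : k ≠ i := ne_of_lt hk
      have hk2 : k ≠ i' := ne_of_lt (lt_trans hk hii)
      simp only [Equiv.trans_apply, Equiv.swap_apply_of_ne_of_ne hk1 hk2]
    · simpa only [Equiv.trans_apply, Equiv.swap_apply_left] using hlt

/-- **Doubly lexical orderings exist**: some row permutation and column permutation make the rows and the columns of `M` lexicographically
non-increasing at the same time. -/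
theorem exists_doublyLex (M : Fin m → Fin n → α) : ∃ (ρ : Equiv.Perm (Fin m)) (τ : Equiv.Perm (Fin n)), IsDoublyLex M ρ τ := by
  obtain ⟨x, -, hmax⟩ := exists_max_image (univ : Finset (Equiv.Perm (Fin m) × Equiv.Perm (Fin n))) (pot M) (univ_nonempty)
  refine ⟨x.1, x.2, ⟨fun i i' hii => ?_, fun j j' hjj => ?_⟩⟩
  · by_contra hv
    rw [not_le] at hv
    exact absurd (hmax _ (mem_univ _)) (not_le.2 (pot_lt_swap_rows M x.1 x.2 hii hv))
  · by_contra hv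
    rw [not_le] at hv
    exact absurd (hmax _ (mem_univ _)) (not_le.2 (pot_lt_swap_cols M x.1 x.2 hjj hv))

/-- the adjacent form used by enumerators: consecutive rows and consecutive columns are non-increasing -/
theorem exists_doublyLex_succ (M : Fin m → Fin n → α) : ∃ (ρ : Equiv.Perm (Fin m)) (τ : Equiv.Perm (Fin n)),
    (∀ i i' : Fin m, i.1 + 1 = i'.1 → row M ρ τ i' ≤ row M ρ τ i) ∧ (∀ j j' : Fin n, j.1 + 1 = j'.1 → col M ρ τ j' ≤ col M ρ τ j) := by
  obtain ⟨ρ, τ, hr, hc⟩ := exists_doublyLex M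
  exact ⟨ρ, τ, fun i i' h => hr i i' (by rw [Fin.lt_def]; omega), fun j j' h => hc j j' (by rw [Fin.lt_def]; omega)⟩

end DoublyLex

end Summit.Ventures.DiscreteObjects.PP12
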